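import Summits.HodgeConjecture.HodgeConjecture.Theorems.K2E1SelfDualResidueClassMemCharLineOfLettersCMTwo   -- ★ p862022 (this seat, (B) PART 2): `mem_iSup_lineSubrep_cmDetChar_quasiSplit_of_ae_eq{,_residue}`, `residueClass_mem_iSup_lineSubrep_of_levelLetters_cm_two`; brings ★ (B) PART 1 p861962, ★ T2 FINAL, ★ p861677
import Summits.HodgeConjecture.HodgeConjecture.Theorems.R90S8ResHBlockDataU2Defs                       -- ★ p862464 (K2E1-p15, H4″ DEFS of record R1): `resHBlock`, `resHAtom (U) := resHBlock ⊓ ker (snd ∘ U)`, `resHLine`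
import Mathlib.LinearAlgebra.Prod
import HarnessLib

/-!
# R90-TF · S8 «ContSpec-n½» — `R90S8ResHResiduesAreCharLinesU2`: THE ATOM LETTER (L) OF THE #4′ ASSEMBLY UNDER THE DEF REGIME OF RECORD R1
# — `At = Sc ⊓ ker (snd ∘ U) ≤ ⨆_ψ ℂ·[ψ∘det]`, the pure-atom vectors of a block are character classes, with the block MODEL letter visible

Cell `hodgecm-mathlib`, crux H413 (`stmt-HodgeConjecture-24833`, lane `--supports … --as helper`), route of record `HCCMUnconditional`; R90-TF section S8, deal S8-R29 (3) ∕ S8-R33 (2)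
(R90-CS-plan (g2)) «(L) → K2E2-p12 (g8)»; DEF REGIME OF RECORD R1 (S8-R35 (1); K2E1-p15 (g3) H4″ DEF HEADS 22:17:36Z): `At K' ω b := Sc K' ω b ⊓ ker (snd ∘ U_b)` — the PURE-ATOM
vectors of the block for its model coordinate map `U_b : L² →ₗ[ℂ] A × Λ` (atoms × lines, ★ D5′ ∕ ★ `K2E1ResidueAtomsOfNoLineMassU` currency; K2E1-p15's `R90.S8.resHAtom L μ U K' ω χ :=
resHBlock L μ K' ω χ ⊓ LinearMap.ker ((LinearMap.snd ℂ A Λ).comp U)`).  Consumer: the letter `hL` of ★ p862113 `R90S8ResHLeClosureCharLinesOfLetters` :93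
(`∀ ℓ b, At ℓ b ≤ ⨆ ψ : {ψ ∕∕ automorphic}, (lineSubrep (cmDetChar L 2 ((antidiagonal 2).over L) ψ.1 ψ.2 _) μ).toSubmodule`).  THEOREMS ONLY (no `def`, no `instance`, no notation,
no named-fact hypothesis, no `sorry`; default heartbeats); count-neutral; GENERIC in the level datum and in the block (LETTER SHAPE RULE S8-R29 (2)): the block enters only through
the submodule `Sc` and the model map `U`, so the by-name instance at `R90.S8.resHAtom` is `Iff.rfl`-deep (`resHAtom = resHBlock ⊓ ker (snd ∘ U)` by definition).

THE MATHEMATICS ([MoeglinWaldspurger1995, IV.1.11, V.3.13]; [Rogawski1990, §13.9 (i) p. 229]).  Under R1 the (L) letter splits into exactly two inputs: the MODEL LETTER «the atom slots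
of the block isometry are spanned by finitely many residue classes `e i`» — `∀ v ∈ Sc, (U v).2 = 0 → v ∈ span (range e)` (the self-dual block package ★ G9 ∕ `…SelfDualM1CMTwoComplete`
read through ★ `K2E1PlancherelModelMapOfIsometry`; VISIBLE here, discharged by the H7 assembly at the level family) — and the RESIDUE LETTER per atom «`e i` is a.e. `x ↦ r·Θ((out x)⁻¹)`
for an automorphic character `Θ`» — which is ★: ★ (β2) p862111 places every weighted pole of a self-dual `χ`-block at `z = 1` with `χ₀ = 1`, ★ p861677 then writes `χ = (χ̃_ψ)⁻¹`,
and ★ T2 FINAL `residue_detTwist_eq_const_mul_level_cm_two` (through ★ (B) PART 2's dictionary and payment `residueClass_mem_iSup_lineSubrep_of_levelLetters_cm_two`) gives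
`Res = r·(ψ∘det)`; ★ (B) PART 1∕2 turn the a.e. identity into membership in `⨆_ψ ℂ·[ψ∘det]`.  So `At = Sc ⊓ ker (snd ∘ U) ≤ span (range e) ≤ ⨆_ψ ℂ·[ψ∘det]` (`Submodule.span_le`).
* §1 `inf_ker_snd_le_span_of_atoms` — the model letter in submodule form: `Sc ⊓ ker (snd ∘ U) ≤ span (range e)`.
* §2 **`inf_ker_snd_le_iSup_lineSubrep_of_mem`** — (L) from the model letter and per-atom MEMBERSHIP `e i ∈ ⨆_ψ lines` (the shape ★ (B) PART 2's payment concludes);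
  **`inf_ker_snd_le_iSup_lineSubrep_of_ae_eq`** — per-atom letter in the a.e. form `⇑(e i) =ᵐ x ↦ r·Θ((out x)⁻¹)` (★ `mem_iSup_lineSubrep_cmDetChar_quasiSplit_of_ae_eq`);
  **`inf_ker_snd_le_iSup_lineSubrep_of_residue`** — per-atom letter in T2 FINAL's pointwise-residue form `F g = r·Θ g`, `⇑(e i) =ᵐ x ↦ F((out x)⁻¹)` (★ `…_of_ae_eq_residue`).
* §3 **`hL_of_atoms`** — the PRINT's letter `hL` over an index family `(ℓ, b)` with `At ℓ b := Sc ℓ b ⊓ ker (snd ∘ U ℓ b)`, from the two letters per `(ℓ, b)`.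
* §4 BY NAME at ★ K2E1-p15's DEFS (`Iff.rfl`-deep): **`resHAtom_le_iSup_lineSubrep_of_mem ∕ _of_ae_eq ∕ _of_residue`** and **`hL_resHAtom_of_atoms`** — `hL` VERBATIM at the consumer's
  `At := fun ℓ b => resHAtom L μ (U ℓ b) (K' ℓ) (ω ℓ) ↑b` (H7's instantiation, S8-R44).
HONEST LABEL: HC_CM is proved only modulo the 7 printed citations (2 remaining named inputs: hLiu418 = `stmt-HodgeConjecture-24832`, h413 = `stmt-HodgeConjecture-24833`) until rung 0
closes; count-neutral helper; closes no socket; (L) is discharged MODULO the visible model letter (the atom-slot identification of the block isometry, G9∕H7's debt) — the residue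
letter is ★ per atom.

## References
* [MoeglinWaldspurger1995] C. Mœglin, J.-L. Waldspurger, *Spectral Decomposition and Eisenstein Series* (1995), IV.1.11 (residues of rank-one Eisenstein series), V.3.13 (the residual spectrum is spanned by residues).
* [Rogawski1990] J. D. Rogawski, *Automorphic Representations of Unitary Groups in Three Variables* (1990), §13.9 (i) p. 229, §13.3 p. 202.
-/

set_option autoImplicit false
-- the mandated namespace repeats the single-problem summit's segment (`HodgeConjecture.HodgeConjecture`)
set_option linter.dupNamespace false

noncomputable section

open MeasureTheory Measure NumberField Set Filter Topology
open Literature.NumberTheory.Automorphic Literature.NumberTheory.Automorphic.UnitaryGroup AdelicGroupData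
open Literature.NumberTheory.Automorphic.Arthur2013.Leaves.TECR
open Literature.NumberTheory.GaloisRepresentations (HeckeCharacter)
open Summit.HodgeConjecture.HodgeConjecture.Cruxes.H413.K2E1ChiSectionSpaceU2Defs
open scoped NNReal
open Summit.HodgeConjecture.HodgeConjecture.Cruxes.H413.K2E1SelfDualResidueClassMemCharLineOfLettersCMTwo
  (mem_iSup_lineSubrep_cmDetChar_quasiSplit_of_ae_eq mem_iSup_lineSubrep_cmDetChar_quasiSplit_of_ae_eq_residue)

namespace Summit.HodgeConjecture.HodgeConjecture.R90.S8

/-! ## §1 The model letter in submodule form -/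

section Model

variable {H : Type*} [AddCommGroup H] [Module ℂ H] {A Λ : Type*} [AddCommGroup A] [Module ℂ A] [AddCommGroup Λ] [Module ℂ Λ]

/-- **THE MODEL LETTER, SUBMODULE FORM**: if every pure-atom vector of `Sc` (line coordinate `(U v).2 = 0`) lies in the span of the atom family `e`, then `Sc ⊓ ker (snd ∘ U) ≤ span (range e)`.
[cite: MoeglinWaldspurger1995, V.3.13] -/
theorem inf_ker_snd_le_span_of_atoms (U : H →ₗ[ℂ] A × Λ) (Sc : Submodule ℂ H) {ιa : Type*} (e : ιa → H)
    (hatom : ∀ v ∈ Sc, (U v).2 = 0 → v ∈ Submodule.span ℂ (Set.range e)) :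
    Sc ⊓ LinearMap.ker ((LinearMap.snd ℂ A Λ).comp U) ≤ Submodule.span ℂ (Set.range e) := fun v hv =>
  hatom v hv.1 (LinearMap.mem_ker.1 (Submodule.mem_inf.1 hv).2)

/-- **… hence below any submodule containing the atoms**: `(∀ i, e i ∈ T) → Sc ⊓ ker (snd ∘ U) ≤ T`. [cite: MoeglinWaldspurger1995, V.3.13] -/
theorem inf_ker_snd_le_of_atoms_mem (U : H →ₗ[ℂ] A × Λ) (Sc : Submodule ℂ H) {ιa : Type*} (e : ιa → H)
    (hatom : ∀ v ∈ Sc, (U v).2 = 0 → v ∈ Submodule.span ℂ (Set.range e)) (T : Submodule ℂ H) (he : ∀ i, e i ∈ T) :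
    Sc ⊓ LinearMap.ker ((LinearMap.snd ℂ A Λ).comp U) ≤ T :=
  (inf_ker_snd_le_span_of_atoms U Sc e hatom).trans (Submodule.span_le.2 (Set.range_subset_iff.2 he))

end Model

/-! ## §2 (L) at `U(1,1)_{L∕L⁺}`: pure-atom vectors are character classes -/

section CM

variable (L : Type) [Field L] [NumberField L] [IsCMField L]
  (μ : Measure (quasiSplit (↥(maximalRealSubfield L)) L (IsCMField.complexConj L) 2).automorphicQuotient) [(quasiSplit (↥(maximalRealSubfield L)) L (IsCMField.complexConj L) 2).IsAutomorphicMeasure μ]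
  {A Λ : Type*} [AddCommGroup A] [Module ℂ A] [AddCommGroup Λ] [Module ℂ Λ]

/-- **(L), MEMBERSHIP FORM**: for a block `Sc ≤ L²` with model map `U : L² →ₗ A × Λ`, the MODEL LETTER (atom slots spanned by the residue classes `e i`) and the per-atom membership
`e i ∈ ⨆_ψ ℂ·[ψ∘det]` (the conclusion shape of ★ (B) PART 2 `residueClass_mem_iSup_lineSubrep_of_levelLetters_cm_two`) give `Sc ⊓ ker (snd ∘ U) ≤ ⨆_ψ ℂ·[ψ∘det]`.
[cite: MoeglinWaldspurger1995, V.3.13] [cite: Rogawski1990, §13.9 (i) p. 229] -/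
theorem inf_ker_snd_le_iSup_lineSubrep_of_mem (U : (quasiSplit (↥(maximalRealSubfield L)) L (IsCMField.complexConj L) 2).L2 μ →ₗ[ℂ] A × Λ)
    (Sc : Submodule ℂ ((quasiSplit (↥(maximalRealSubfield L)) L (IsCMField.complexConj L) 2).L2 μ)) {ιa : Type*} (e : ιa → (quasiSplit (↥(maximalRealSubfield L)) L (IsCMField.complexConj L) 2).L2 μ)
    (hatom : ∀ v ∈ Sc, (U v).2 = 0 → v ∈ Submodule.span ℂ (Set.range e))
    (he : ∀ i, e i ∈ ⨆ ψ : {ψ : ↥(TorusDict.torus (IsCMField.complexConj L)) →ₜ* ℂˣ // TorusDict.IsAutomorphic (IsCMField.complexConj L) ψ},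
      (AdelicGroupData.AutomorphicCharacter.lineSubrep (𝒢 := (quasiSplit (↥(maximalRealSubfield L)) L (IsCMField.complexConj L) 2))
        (cmDetChar L 2 ((StdForm.antidiagonal 2).over L) ψ.1 ψ.2 ((Matrix.isUnit_iff_isUnit_det _).mp (StdForm.isUnit_over (StdForm.antidiagonal 2) L)).ne_zero) μ).toSubmodule) :
    Sc ⊓ LinearMap.ker ((LinearMap.snd ℂ A Λ).comp U) ≤ ⨆ ψ : {ψ : ↥(TorusDict.torus (IsCMField.complexConj L)) →ₜ* ℂˣ // TorusDict.IsAutomorphic (IsCMField.complexConj L) ψ},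
      (AdelicGroupData.AutomorphicCharacter.lineSubrep (𝒢 := (quasiSplit (↥(maximalRealSubfield L)) L (IsCMField.complexConj L) 2))
        (cmDetChar L 2 ((StdForm.antidiagonal 2).over L) ψ.1 ψ.2 ((Matrix.isUnit_iff_isUnit_det _).mp (StdForm.isUnit_over (StdForm.antidiagonal 2) L)).ne_zero) μ).toSubmodule :=
  inf_ker_snd_le_of_atoms_mem U Sc e hatom _ he

/-- **(L), A.E. FORM**: the model letter plus, per atom, an automorphic character `Θ_i` and a scalar `r_i` with `⇑(e i) =ᵐ x ↦ r_i·Θ_i((out x)⁻¹)` (the residue class of a self-dual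
block — at `z = 1`, `χ₀ = 1` by ★ (β2) p862111 — is `r·(ψ∘det)` by ★ T2 FINAL) give `Sc ⊓ ker (snd ∘ U) ≤ ⨆_ψ ℂ·[ψ∘det]` (★ (B) `mem_iSup_lineSubrep_cmDetChar_quasiSplit_of_ae_eq`).
[cite: MoeglinWaldspurger1995, IV.1.11] [cite: Rogawski1990, §13.9 (i) p. 229] -/
theorem inf_ker_snd_le_iSup_lineSubrep_of_ae_eq (U : (quasiSplit (↥(maximalRealSubfield L)) L (IsCMField.complexConj L) 2).L2 μ →ₗ[ℂ] A × Λ)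
    (Sc : Submodule ℂ ((quasiSplit (↥(maximalRealSubfield L)) L (IsCMField.complexConj L) 2).L2 μ)) {ιa : Type*} (e : ιa → (quasiSplit (↥(maximalRealSubfield L)) L (IsCMField.complexConj L) 2).L2 μ)
    (hatom : ∀ v ∈ Sc, (U v).2 = 0 → v ∈ Submodule.span ℂ (Set.range e))
    (he : ∀ i, ∃ (Θ : (quasiSplit (↥(maximalRealSubfield L)) L (IsCMField.complexConj L) 2).AutomorphicCharacter) (r : ℂ),
      ((e i : (quasiSplit (↥(maximalRealSubfield L)) L (IsCMField.complexConj L) 2).L2 μ) : (quasiSplit (↥(maximalRealSubfield L)) L (IsCMField.complexConj L) 2).automorphicQuotient → ℂ) =ᵐ[μ]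
        fun x => r * ((Θ (Quotient.out (x : (quasiSplit (↥(maximalRealSubfield L)) L (IsCMField.complexConj L) 2).Adelic ⧸ (quasiSplit (↥(maximalRealSubfield L)) L (IsCMField.complexConj L) 2).quotientSubgroup))⁻¹ : ℂˣ) : ℂ)) :
    Sc ⊓ LinearMap.ker ((LinearMap.snd ℂ A Λ).comp U) ≤ ⨆ ψ : {ψ : ↥(TorusDict.torus (IsCMField.complexConj L)) →ₜ* ℂˣ // TorusDict.IsAutomorphic (IsCMField.complexConj L) ψ},
      (AdelicGroupData.AutomorphicCharacter.lineSubrep (𝒢 := (quasiSplit (↥(maximalRealSubfield L)) L (IsCMField.complexConj L) 2))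
        (cmDetChar L 2 ((StdForm.antidiagonal 2).over L) ψ.1 ψ.2 ((Matrix.isUnit_iff_isUnit_det _).mp (StdForm.isUnit_over (StdForm.antidiagonal 2) L)).ne_zero) μ).toSubmodule :=
  inf_ker_snd_le_of_atoms_mem U Sc e hatom _ fun i => by
    obtain ⟨Θ, r, h⟩ := he i
    exact mem_iSup_lineSubrep_cmDetChar_quasiSplit_of_ae_eq L μ Θ r h

/-- **(L), POINTWISE-RESIDUE FORM**: the model letter plus, per atom, T2 FINAL's conclusion shape `∀ g, F g = r·Θ g` (★ `residue_detTwist_eq_const_mul_level_cm_two`) and the (L-AE)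
identification `⇑(e i) =ᵐ x ↦ F((out x)⁻¹)` give `Sc ⊓ ker (snd ∘ U) ≤ ⨆_ψ ℂ·[ψ∘det]` (★ (B) `mem_iSup_lineSubrep_cmDetChar_quasiSplit_of_ae_eq_residue`).
[cite: MoeglinWaldspurger1995, IV.1.11] [cite: Rogawski1990, §13.9 (i) p. 229] -/
theorem inf_ker_snd_le_iSup_lineSubrep_of_residue (U : (quasiSplit (↥(maximalRealSubfield L)) L (IsCMField.complexConj L) 2).L2 μ →ₗ[ℂ] A × Λ)
    (Sc : Submodule ℂ ((quasiSplit (↥(maximalRealSubfield L)) L (IsCMField.complexConj L) 2).L2 μ)) {ιa : Type*} (e : ιa → (quasiSplit (↥(maximalRealSubfield L)) L (IsCMField.complexConj L) 2).L2 μ)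
    (hatom : ∀ v ∈ Sc, (U v).2 = 0 → v ∈ Submodule.span ℂ (Set.range e))
    (he : ∀ i, ∃ (Θ : (quasiSplit (↥(maximalRealSubfield L)) L (IsCMField.complexConj L) 2).AutomorphicCharacter)
      (F : (quasiSplit (↥(maximalRealSubfield L)) L (IsCMField.complexConj L) 2).Adelic → ℂ) (r : ℂ), (∀ g, F g = r * ((Θ g : ℂˣ) : ℂ)) ∧
      ((e i : (quasiSplit (↥(maximalRealSubfield L)) L (IsCMField.complexConj L) 2).L2 μ) : (quasiSplit (↥(maximalRealSubfield L)) L (IsCMField.complexConj L) 2).automorphicQuotient → ℂ) =ᵐ[μ]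
        fun x => F (Quotient.out (x : (quasiSplit (↥(maximalRealSubfield L)) L (IsCMField.complexConj L) 2).Adelic ⧸ (quasiSplit (↥(maximalRealSubfield L)) L (IsCMField.complexConj L) 2).quotientSubgroup))⁻¹) :
    Sc ⊓ LinearMap.ker ((LinearMap.snd ℂ A Λ).comp U) ≤ ⨆ ψ : {ψ : ↥(TorusDict.torus (IsCMField.complexConj L)) →ₜ* ℂˣ // TorusDict.IsAutomorphic (IsCMField.complexConj L) ψ},
      (AdelicGroupData.AutomorphicCharacter.lineSubrep (𝒢 := (quasiSplit (↥(maximalRealSubfield L)) L (IsCMField.complexConj L) 2))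
        (cmDetChar L 2 ((StdForm.antidiagonal 2).over L) ψ.1 ψ.2 ((Matrix.isUnit_iff_isUnit_det _).mp (StdForm.isUnit_over (StdForm.antidiagonal 2) L)).ne_zero) μ).toSubmodule :=
  inf_ker_snd_le_of_atoms_mem U Sc e hatom _ fun i => by
    obtain ⟨Θ, F, r, hres, h⟩ := he i
    exact mem_iSup_lineSubrep_cmDetChar_quasiSplit_of_ae_eq_residue L μ Θ hres h

/-! ## §3 The PRINT's letter `hL` over an index family -/

/-- **THE LETTER `hL` OF ★ p862113 FROM THE TWO LETTERS PER INDEX**: for any index type `ι`, block index types `B ℓ`, blocks `Sc ℓ b`, model maps `U ℓ b : L² →ₗ A ℓ b × Λ ℓ b` and atom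
families `e ℓ b` with the model letter and the per-atom a.e. residue letter, the R1 atoms `At ℓ b := Sc ℓ b ⊓ ker (snd ∘ U ℓ b)` satisfy `∀ ℓ b, At ℓ b ≤ ⨆_ψ ℂ·[ψ∘det]` — the `hL`
binder's shape. [cite: MoeglinWaldspurger1995, IV.1.11, V.3.13] [cite: Rogawski1990, §13.9 (i) p. 229] -/
theorem hL_of_atoms {ι : Type*} {B : ι → Type*} {Aℓ Λℓ : ∀ ℓ, B ℓ → Type*} [∀ ℓ b, AddCommGroup (Aℓ ℓ b)] [∀ ℓ b, Module ℂ (Aℓ ℓ b)] [∀ ℓ b, AddCommGroup (Λℓ ℓ b)]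
    [∀ ℓ b, Module ℂ (Λℓ ℓ b)] (Sc : ∀ ℓ, B ℓ → Submodule ℂ ((quasiSplit (↥(maximalRealSubfield L)) L (IsCMField.complexConj L) 2).L2 μ))
    (U : ∀ ℓ (b : B ℓ), (quasiSplit (↥(maximalRealSubfield L)) L (IsCMField.complexConj L) 2).L2 μ →ₗ[ℂ] Aℓ ℓ b × Λℓ ℓ b) {ιa : ∀ ℓ, B ℓ → Type*}
    (e : ∀ ℓ (b : B ℓ), ιa ℓ b → (quasiSplit (↥(maximalRealSubfield L)) L (IsCMField.complexConj L) 2).L2 μ)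
    (hatom : ∀ ℓ b, ∀ v ∈ Sc ℓ b, (U ℓ b v).2 = 0 → v ∈ Submodule.span ℂ (Set.range (e ℓ b)))
    (he : ∀ ℓ b i, ∃ (Θ : (quasiSplit (↥(maximalRealSubfield L)) L (IsCMField.complexConj L) 2).AutomorphicCharacter) (r : ℂ),
      ((e ℓ b i : (quasiSplit (↥(maximalRealSubfield L)) L (IsCMField.complexConj L) 2).L2 μ) : (quasiSplit (↥(maximalRealSubfield L)) L (IsCMField.complexConj L) 2).automorphicQuotient → ℂ) =ᵐ[μ]
        fun x => r * ((Θ (Quotient.out (x : (quasiSplit (↥(maximalRealSubfield L)) L (IsCMField.complexConj L) 2).Adelic ⧸ (quasiSplit (↥(maximalRealSubfield L)) L (IsCMField.complexConj L) 2).quotientSubgroup))⁻¹ : ℂˣ) : ℂ)) :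
    ∀ (ℓ : ι) (b : B ℓ), Sc ℓ b ⊓ LinearMap.ker ((LinearMap.snd ℂ (Aℓ ℓ b) (Λℓ ℓ b)).comp (U ℓ b)) ≤
      ⨆ ψ : {ψ : ↥(TorusDict.torus (IsCMField.complexConj L)) →ₜ* ℂˣ // TorusDict.IsAutomorphic (IsCMField.complexConj L) ψ},
        (AdelicGroupData.AutomorphicCharacter.lineSubrep (𝒢 := (quasiSplit (↥(maximalRealSubfield L)) L (IsCMField.complexConj L) 2))
          (cmDetChar L 2 ((StdForm.antidiagonal 2).over L) ψ.1 ψ.2 ((Matrix.isUnit_iff_isUnit_det _).mp (StdForm.isUnit_over (StdForm.antidiagonal 2) L)).ne_zero) μ).toSubmodule :=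
  fun ℓ b => inf_ker_snd_le_iSup_lineSubrep_of_ae_eq L μ (U ℓ b) (Sc ℓ b) (e ℓ b) (hatom ℓ b) (he ℓ b)

/-! ## §4 BY NAME at the DEFS of record: `resHAtom L μ U K' ω χ ≤ ⨆_ψ ℂ·[ψ∘det]` -/

/-- **(L) BY NAME, MEMBERSHIP FORM**: `resHAtom L μ U K' ω χ ≤ ⨆_ψ ℂ·[ψ∘det]` from the model letter over `resHBlock L μ K' ω χ` and per-atom membership (★ DEFS `resHAtom := resHBlock ⊓ ker (snd ∘ U)`).
[cite: MoeglinWaldspurger1995, V.3.13] [cite: Rogawski1990, §13.9 (i) p. 229] -/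
theorem resHAtom_le_iSup_lineSubrep_of_mem (U : (quasiSplit (↥(maximalRealSubfield L)) L (IsCMField.complexConj L) 2).L2 μ →ₗ[ℂ] A × Λ)
    (K' : Subgroup (quasiSplit (↥(maximalRealSubfield L)) L (IsCMField.complexConj L) 2).Adelic) (ω : ↥K' →* ℂ) (χ : HeckeCharacter L)
    {ιa : Type*} (e : ιa → (quasiSplit (↥(maximalRealSubfield L)) L (IsCMField.complexConj L) 2).L2 μ)
    (hatom : ∀ v ∈ resHBlock L μ K' ω χ, (U v).2 = 0 → v ∈ Submodule.span ℂ (Set.range e))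
    (he : ∀ i, e i ∈ ⨆ ψ : {ψ : ↥(TorusDict.torus (IsCMField.complexConj L)) →ₜ* ℂˣ // TorusDict.IsAutomorphic (IsCMField.complexConj L) ψ},
      (AdelicGroupData.AutomorphicCharacter.lineSubrep (𝒢 := (quasiSplit (↥(maximalRealSubfield L)) L (IsCMField.complexConj L) 2))
        (cmDetChar L 2 ((StdForm.antidiagonal 2).over L) ψ.1 ψ.2 ((Matrix.isUnit_iff_isUnit_det _).mp (StdForm.isUnit_over (StdForm.antidiagonal 2) L)).ne_zero) μ).toSubmodule) :
    resHAtom L μ U K' ω χ ≤ ⨆ ψ : {ψ : ↥(TorusDict.torus (IsCMField.complexConj L)) →ₜ* ℂˣ // TorusDict.IsAutomorphic (IsCMField.complexConj L) ψ},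
      (AdelicGroupData.AutomorphicCharacter.lineSubrep (𝒢 := (quasiSplit (↥(maximalRealSubfield L)) L (IsCMField.complexConj L) 2))
        (cmDetChar L 2 ((StdForm.antidiagonal 2).over L) ψ.1 ψ.2 ((Matrix.isUnit_iff_isUnit_det _).mp (StdForm.isUnit_over (StdForm.antidiagonal 2) L)).ne_zero) μ).toSubmodule :=
  inf_ker_snd_le_iSup_lineSubrep_of_mem L μ U (resHBlock L μ K' ω χ) e hatom he

/-- **(L) BY NAME, A.E. FORM**: `resHAtom L μ U K' ω χ ≤ ⨆_ψ ℂ·[ψ∘det]` from the model letter and, per atom, `⇑(e i) =ᵐ x ↦ r·Θ((out x)⁻¹)` for an automorphic character `Θ`.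
[cite: MoeglinWaldspurger1995, IV.1.11] [cite: Rogawski1990, §13.9 (i) p. 229] -/
theorem resHAtom_le_iSup_lineSubrep_of_ae_eq (U : (quasiSplit (↥(maximalRealSubfield L)) L (IsCMField.complexConj L) 2).L2 μ →ₗ[ℂ] A × Λ)
    (K' : Subgroup (quasiSplit (↥(maximalRealSubfield L)) L (IsCMField.complexConj L) 2).Adelic) (ω : ↥K' →* ℂ) (χ : HeckeCharacter L)
    {ιa : Type*} (e : ιa → (quasiSplit (↥(maximalRealSubfield L)) L (IsCMField.complexConj L) 2).L2 μ)
    (hatom : ∀ v ∈ resHBlock L μ K' ω χ, (U v).2 = 0 → v ∈ Submodule.span ℂ (Set.range e))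
    (he : ∀ i, ∃ (Θ : (quasiSplit (↥(maximalRealSubfield L)) L (IsCMField.complexConj L) 2).AutomorphicCharacter) (r : ℂ),
      ((e i : (quasiSplit (↥(maximalRealSubfield L)) L (IsCMField.complexConj L) 2).L2 μ) : (quasiSplit (↥(maximalRealSubfield L)) L (IsCMField.complexConj L) 2).automorphicQuotient → ℂ) =ᵐ[μ]
        fun x => r * ((Θ (Quotient.out (x : (quasiSplit (↥(maximalRealSubfield L)) L (IsCMField.complexConj L) 2).Adelic ⧸ (quasiSplit (↥(maximalRealSubfield L)) L (IsCMField.complexConj L) 2).quotientSubgroup))⁻¹ : ℂˣ) : ℂ)) :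
    resHAtom L μ U K' ω χ ≤ ⨆ ψ : {ψ : ↥(TorusDict.torus (IsCMField.complexConj L)) →ₜ* ℂˣ // TorusDict.IsAutomorphic (IsCMField.complexConj L) ψ},
      (AdelicGroupData.AutomorphicCharacter.lineSubrep (𝒢 := (quasiSplit (↥(maximalRealSubfield L)) L (IsCMField.complexConj L) 2))
        (cmDetChar L 2 ((StdForm.antidiagonal 2).over L) ψ.1 ψ.2 ((Matrix.isUnit_iff_isUnit_det _).mp (StdForm.isUnit_over (StdForm.antidiagonal 2) L)).ne_zero) μ).toSubmodule :=
  inf_ker_snd_le_iSup_lineSubrep_of_ae_eq L μ U (resHBlock L μ K' ω χ) e hatom he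

/-- **(L) BY NAME, POINTWISE-RESIDUE FORM**: `resHAtom L μ U K' ω χ ≤ ⨆_ψ ℂ·[ψ∘det]` from the model letter and, per atom, T2 FINAL's `∀ g, F g = r·Θ g` with `⇑(e i) =ᵐ x ↦ F((out x)⁻¹)`.
[cite: MoeglinWaldspurger1995, IV.1.11] [cite: Rogawski1990, §13.9 (i) p. 229] -/
theorem resHAtom_le_iSup_lineSubrep_of_residue (U : (quasiSplit (↥(maximalRealSubfield L)) L (IsCMField.complexConj L) 2).L2 μ →ₗ[ℂ] A × Λ)
    (K' : Subgroup (quasiSplit (↥(maximalRealSubfield L)) L (IsCMField.complexConj L) 2).Adelic) (ω : ↥K' →* ℂ) (χ : HeckeCharacter L)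
    {ιa : Type*} (e : ιa → (quasiSplit (↥(maximalRealSubfield L)) L (IsCMField.complexConj L) 2).L2 μ)
    (hatom : ∀ v ∈ resHBlock L μ K' ω χ, (U v).2 = 0 → v ∈ Submodule.span ℂ (Set.range e))
    (he : ∀ i, ∃ (Θ : (quasiSplit (↥(maximalRealSubfield L)) L (IsCMField.complexConj L) 2).AutomorphicCharacter)
      (F : (quasiSplit (↥(maximalRealSubfield L)) L (IsCMField.complexConj L) 2).Adelic → ℂ) (r : ℂ), (∀ g, F g = r * ((Θ g : ℂˣ) : ℂ)) ∧
      ((e i : (quasiSplit (↥(maximalRealSubfield L)) L (IsCMField.complexConj L) 2).L2 μ) : (quasiSplit (↥(maximalRealSubfield L)) L (IsCMField.complexConj L) 2).automorphicQuotient → ℂ) =ᵐ[μ]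
        fun x => F (Quotient.out (x : (quasiSplit (↥(maximalRealSubfield L)) L (IsCMField.complexConj L) 2).Adelic ⧸ (quasiSplit (↥(maximalRealSubfield L)) L (IsCMField.complexConj L) 2).quotientSubgroup))⁻¹) :
    resHAtom L μ U K' ω χ ≤ ⨆ ψ : {ψ : ↥(TorusDict.torus (IsCMField.complexConj L)) →ₜ* ℂˣ // TorusDict.IsAutomorphic (IsCMField.complexConj L) ψ},
      (AdelicGroupData.AutomorphicCharacter.lineSubrep (𝒢 := (quasiSplit (↥(maximalRealSubfield L)) L (IsCMField.complexConj L) 2))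
        (cmDetChar L 2 ((StdForm.antidiagonal 2).over L) ψ.1 ψ.2 ((Matrix.isUnit_iff_isUnit_det _).mp (StdForm.isUnit_over (StdForm.antidiagonal 2) L)).ne_zero) μ).toSubmodule :=
  inf_ker_snd_le_iSup_lineSubrep_of_residue L μ U (resHBlock L μ K' ω χ) e hatom he

/-- **THE PRINT'S `hL` AT THE CONSUMER'S INSTANTIATION** `At := fun ℓ b => resHAtom L μ (U ℓ b) (K' ℓ) (ω ℓ) ↑b` (H7, S8-R44): for levels `K' : ι → Subgroup`, characters `ω ℓ`, the block
index sets of the print, model maps `U ℓ b` and atom families `e ℓ b` with the model letter and the per-atom a.e. residue letter: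
`∀ ℓ b, resHAtom L μ (U ℓ b) (K' ℓ) (ω ℓ) ↑b ≤ ⨆_ψ ℂ·[ψ∘det]` — the `hL` binder of ★ `residual_le_topologicalClosure_iSup_charLines_of_letters[_kad]` VERBATIM.
[cite: MoeglinWaldspurger1995, IV.1.11, V.3.13] [cite: Rogawski1990, §13.9 (i) p. 229] -/
theorem hL_resHAtom_of_atoms {ι : Type*} (K' : ι → Subgroup (quasiSplit (↥(maximalRealSubfield L)) L (IsCMField.complexConj L) 2).Adelic) (ω : ∀ ℓ, ↥(K' ℓ) →* ℂ)
    {Aℓ Λℓ : ∀ ℓ : ι, ↥{χ : HeckeCharacter L | (∀ r : ℝ≥0ˣ, χ (posRealIdele L r) = 1) ∧ chiSectionSpace χ (K' ℓ) (ω ℓ : ↥(K' ℓ) → ℂ) ≠ ⊥} → Type*}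
    [∀ ℓ b, AddCommGroup (Aℓ ℓ b)] [∀ ℓ b, Module ℂ (Aℓ ℓ b)] [∀ ℓ b, AddCommGroup (Λℓ ℓ b)] [∀ ℓ b, Module ℂ (Λℓ ℓ b)]
    (U : ∀ ℓ (b : ↥{χ : HeckeCharacter L | (∀ r : ℝ≥0ˣ, χ (posRealIdele L r) = 1) ∧ chiSectionSpace χ (K' ℓ) (ω ℓ : ↥(K' ℓ) → ℂ) ≠ ⊥}),
      (quasiSplit (↥(maximalRealSubfield L)) L (IsCMField.complexConj L) 2).L2 μ →ₗ[ℂ] Aℓ ℓ b × Λℓ ℓ b)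
    {ιa : ∀ ℓ : ι, ↥{χ : HeckeCharacter L | (∀ r : ℝ≥0ˣ, χ (posRealIdele L r) = 1) ∧ chiSectionSpace χ (K' ℓ) (ω ℓ : ↥(K' ℓ) → ℂ) ≠ ⊥} → Type*}
    (e : ∀ ℓ (b : ↥{χ : HeckeCharacter L | (∀ r : ℝ≥0ˣ, χ (posRealIdele L r) = 1) ∧ chiSectionSpace χ (K' ℓ) (ω ℓ : ↥(K' ℓ) → ℂ) ≠ ⊥}),
      ιa ℓ b → (quasiSplit (↥(maximalRealSubfield L)) L (IsCMField.complexConj L) 2).L2 μ)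
    (hatom : ∀ (ℓ : ι) (b : ↥{χ : HeckeCharacter L | (∀ r : ℝ≥0ˣ, χ (posRealIdele L r) = 1) ∧ chiSectionSpace χ (K' ℓ) (ω ℓ : ↥(K' ℓ) → ℂ) ≠ ⊥}),
      ∀ v ∈ resHBlock L μ (K' ℓ) (ω ℓ) (b : HeckeCharacter L), (U ℓ b v).2 = 0 → v ∈ Submodule.span ℂ (Set.range (e ℓ b)))
    (he : ∀ ℓ b i, ∃ (Θ : (quasiSplit (↥(maximalRealSubfield L)) L (IsCMField.complexConj L) 2).AutomorphicCharacter) (r : ℂ),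
      ((e ℓ b i : (quasiSplit (↥(maximalRealSubfield L)) L (IsCMField.complexConj L) 2).L2 μ) : (quasiSplit (↥(maximalRealSubfield L)) L (IsCMField.complexConj L) 2).automorphicQuotient → ℂ) =ᵐ[μ]
        fun x => r * ((Θ (Quotient.out (x : (quasiSplit (↥(maximalRealSubfield L)) L (IsCMField.complexConj L) 2).Adelic ⧸ (quasiSplit (↥(maximalRealSubfield L)) L (IsCMField.complexConj L) 2).quotientSubgroup))⁻¹ : ℂˣ) : ℂ)) :
    ∀ (ℓ : ι) (b : ↥{χ : HeckeCharacter L | (∀ r : ℝ≥0ˣ, χ (posRealIdele L r) = 1) ∧ chiSectionSpace χ (K' ℓ) (ω ℓ : ↥(K' ℓ) → ℂ) ≠ ⊥}),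
      resHAtom L μ (U ℓ b) (K' ℓ) (ω ℓ) (b : HeckeCharacter L) ≤
        ⨆ ψ : {ψ : ↥(TorusDict.torus (IsCMField.complexConj L)) →ₜ* ℂˣ // TorusDict.IsAutomorphic (IsCMField.complexConj L) ψ},
          (AdelicGroupData.AutomorphicCharacter.lineSubrep (𝒢 := (quasiSplit (↥(maximalRealSubfield L)) L (IsCMField.complexConj L) 2))
            (cmDetChar L 2 ((StdForm.antidiagonal 2).over L) ψ.1 ψ.2 ((Matrix.isUnit_iff_isUnit_det _).mp (StdForm.isUnit_over (StdForm.antidiagonal 2) L)).ne_zero) μ).toSubmodule :=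
  fun ℓ b => resHAtom_le_iSup_lineSubrep_of_ae_eq L μ (U ℓ b) (K' ℓ) (ω ℓ) (b : HeckeCharacter L) (e ℓ b) (hatom ℓ b) (he ℓ b)

end CM

end Summit.HodgeConjecture.HodgeConjecture.R90.S8

end
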